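import Literature.NumberTheory.EllipticCurves.Sprung2012.ColemanMapLambdaActionProofs
import Literature.NumberTheory.EllipticCurves.Sprung2012.LocalTowerTraceProofs
import HarnessLib

/-!
# From generation to the dual: the `p`-adic divisibility engine behind the DUAL generation clauses of
# `Sprung2012.IsHondaSystem` (route `PrintX8VS` / `PrintX8`, support item `InputHondaSystem` = stmt-BirchSwinnertonDyer-20413,
# named fact `Sprung2012.thm22_exists_isHondaSystem`; file 10 of the local series)

HONEST FRAMING (desk `pub/bsd-wall/bsd-inputs`, seat `bsd-inputs-honda-p1`, D-0154 (2) INPUTS): THEOREMS ONLY — no definition, no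
named fact, no instance, no `sorry`; abstract bookkeeping over any `K`-field `E`; closes nothing by itself; BSD is not proved by any
of this.

## Setting

Any field `K`, `ℤ_p`-extension `κ`, `K`-field `E` with an embedding `ι : K̄ → Ē`, curve `W/K`; the layers
`E(K_n·E) = localLayerPointsOfEmb κ ι W n`, traces `Tr_{n+1/n} = localTraceOfEmb κ ι W n (n+1)`, a local element `g` restricting
to the topological generator (`κ(res g) = 1`), a functional `z : E(K_n·E) →+ ℤ_p` read on all points by `evalOn` (zero off the
layer). The PRIMAL generation data of a Honda system (Sprung Thm. 2.2 / Kobayashi Prop. 8.12 in `ℤ[Γ]`-form): points `c m ∈ E(K_m·E)`,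
`cneg ∈ E(E)`, an integer `N` prime to `p` with
`N·E(K_m·E) ⊆ ℤ[Γ·c_m] + E(K_{m−1}·E) + p·E(K_m·E)` (`m ≥ 1`) and `N·E(E) ⊆ ℤ·cneg + p·E(E)`.

* §1 `ℤ_p`-bookkeeping: `⋂ pᵏℤ_p = 0`; a functional with values in `pℤ_p` is `p` times a functional; `evalOn` on members.
* §2 `Γ`-orbits through the generator: `σ•x = gʲ•x` for `x` of level `n` and some `j < pⁿ`.
* §3 **the divisibility engine** (`pow_dvd_evalOn_of_generation`): if `p^{K} ∣ z(σ•c_m)` for all `σ`, `m ≤ n`, and `p^{K} ∣ z(cneg)`,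
  then `p^{K} ∣ z(P)` for every `P ∈ E(K_n·E)` (induction on the exponent and the level, using the generation data).
* §4 **orbit propagation** (`pow_dvd_evalOn_orbit_of_relations`): under the trace relations `c_{m−1} = a_p c_m − Tr_{m+1/m} c_{m+1}`
  (`m ≥ 1`), `c_0 = (a_p − 2)·cneg` with `a_p − 2 ∈ ℤ_pˣ`, divisibility of `z` on the `g`-orbits of `c_n`, `c_{n−1}` propagates to all
  `Γ`-orbits `Γ·c_m`, `m ≤ n`, and to `cneg`.

References: [Sprung2012] F. Sprung, J. Number Theory 132 (2012), Thm. 2.2, Cor. 2.10, Lemmas 7.4–7.5; [Kobayashi2003] S. Kobayashi,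
Invent. Math. 152 (2003), Prop. 8.12, Lemma 8.9.
-/

set_option autoImplicit false
-- the Theorems namespace of this sub repeats the summit name by design (D-0017 nested layout)
set_option linter.dupNamespace false

noncomputable section

open scoped Classical
open Finset

universe u

namespace Summit.BirchSwinnertonDyer.BirchSwinnertonDyer.Theorems

namespace SprungHonda

open Literature.NumberTheory.EllipticCurves Literature.NumberTheory.GaloisRepresentations
  Literature.NumberTheory.EllipticCurves.ZpExtension Literature.NumberTheory.EllipticCurves.Kobayashi2003
  Literature.NumberTheory.EllipticCurves.Sprung2012

variable {K : Type u} [Field K] {p : ℕ} [hp : Fact p.Prime] (κ : ZpExtension K p)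
variable {E : Type u} [Field E] [Algebra K E] (ι : AlgebraicClosure K →ₐ[K] AlgebraicClosure E) (W : WeierstrassCurve K)

/-! ## §1 `ℤ_p`-bookkeeping -/

omit hp in
/-- An element of `ℤ_p` divisible by every power of `p` is `0`. [folklore] -/
theorem padicInt_eq_zero_of_forall_pow_dvd [Fact p.Prime] {x : ℤ_[p]} (h : ∀ k : ℕ, (p : ℤ_[p]) ^ k ∣ x) : x = 0 := by
  by_contra hx
  have hpos : 0 < ‖x‖ := norm_pos_iff.mpr hx
  have hp1 : ((p : ℝ))⁻¹ < 1 := inv_lt_one_of_one_lt₀ (by exact_mod_cast (Fact.out : p.Prime).one_lt)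
  obtain ⟨k, hk⟩ := exists_pow_lt_of_lt_one hpos hp1
  have hle : ‖x‖ ≤ (p : ℝ) ^ (-(k : ℤ)) := by
    rw [PadicInt.norm_le_pow_iff_mem_span_pow]
    exact Ideal.mem_span_singleton.mpr (h k)
  rw [zpow_neg, zpow_natCast, ← inv_pow] at hle
  exact absurd (lt_of_le_of_lt hle hk) (lt_irrefl _)

omit hp in
/-- A functional into `ℤ_p` all of whose values lie in `pℤ_p` is `p` times a functional. [folklore] -/
theorem exists_eq_smul_of_forall_dvd [Fact p.Prime] {A : Type*} [AddCommGroup A] (z : A →+ ℤ_[p])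
    (h : ∀ a, (p : ℤ_[p]) ∣ z a) : ∃ y : A →+ ℤ_[p], z = (p : ℤ_[p]) • y := by
  choose f hf using h
  have hp0 : (p : ℤ_[p]) ≠ 0 := by exact_mod_cast (Fact.out : p.Prime).ne_zero
  refine ⟨{ toFun := f, map_zero' := ?_, map_add' := ?_ }, ?_⟩
  · apply mul_left_cancel₀ hp0
    rw [← hf, map_zero, mul_zero]
  · intro a b
    apply mul_left_cancel₀ hp0
    rw [← hf, map_add, hf a, hf b, mul_add]
  · ext a
    rw [AddMonoidHom.smul_apply, smul_eq_mul]
    exact hf a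

/-- An integer prime to `p` is a unit of `ℤ_p`. [folklore] -/
theorem isUnit_natCast_of_coprime {N : ℕ} (hN : N.Coprime p) : IsUnit ((N : ℕ) : ℤ_[p]) := by
  rw [PadicInt.isUnit_iff]
  by_contra hne
  have hlt : ‖((N : ℤ) : ℤ_[p])‖ < 1 := by
    rw [Int.cast_natCast]; exact lt_of_le_of_ne (PadicInt.norm_le_one _) hne
  rw [PadicInt.norm_int_lt_one_iff_dvd] at hlt
  have hpN : p ∣ N := by exact_mod_cast hlt
  have := Nat.eq_one_of_dvd_one (hN ▸ Nat.dvd_gcd hpN dvd_rfl)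
  exact hp.out.one_lt.ne' this

/-- `evalOn` is additive on members. [folklore] -/
theorem evalOn_add_mem (A : AddSubgroup (localPoints W E)) (z : A →+ ℤ_[p]) {P Q : localPoints W E} (hP : P ∈ A)
    (hQ : Q ∈ A) : evalOn W A z (P + Q) = evalOn W A z P + evalOn W A z Q := by
  rw [evalOn_of_mem W A z (add_mem hP hQ), evalOn_of_mem W A z hP, evalOn_of_mem W A z hQ, ← map_add]
  rfl

/-- `evalOn` commutes with `ℤ`-multiples on members. [folklore] -/
theorem evalOn_zsmul_mem (A : AddSubgroup (localPoints W E)) (z : A →+ ℤ_[p]) {P : localPoints W E} (hP : P ∈ A)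
    (k : ℤ) : evalOn W A z (k • P) = k * evalOn W A z P := by
  rw [evalOn_of_mem W A z (zsmul_mem hP k), evalOn_of_mem W A z hP, ← zsmul_eq_mul, ← map_zsmul]
  congr 1

/-- `evalOn` commutes with `ℕ`-multiples on members. [folklore] -/
theorem evalOn_nsmul_mem (A : AddSubgroup (localPoints W E)) (z : A →+ ℤ_[p]) {P : localPoints W E} (hP : P ∈ A)
    (k : ℕ) : evalOn W A z (k • P) = k * evalOn W A z P := by
  rw [← natCast_zsmul, evalOn_zsmul_mem W A z hP, Int.cast_natCast]

/-- `evalOn` is additive over finite sums of members. [folklore] -/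
theorem evalOn_sum_mem (A : AddSubgroup (localPoints W E)) (z : A →+ ℤ_[p]) {α : Type*} (s : Finset α)
    (P : α → localPoints W E) (hP : ∀ a ∈ s, P a ∈ A) :
    evalOn W A z (∑ a ∈ s, P a) = ∑ a ∈ s, evalOn W A z (P a) := by
  classical
  induction s using Finset.induction_on with
  | empty =>
    rw [sum_empty, sum_empty, evalOn_of_mem W A z A.zero_mem]
    exact map_zero z
  | insert a s ha ih =>
    rw [sum_insert ha, sum_insert ha,
      evalOn_add_mem W A z (hP a (mem_insert_self a s)) (A.sum_mem fun b hb ↦ hP b (mem_insert_of_mem hb)),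
      ih fun b hb ↦ hP b (mem_insert_of_mem hb)]

/-- Divisibility of `evalOn z` along the subgroup generated by a set of members. [folklore] -/
theorem dvd_evalOn_of_mem_closure (A : AddSubgroup (localPoints W E)) (z : A →+ ℤ_[p]) {d : ℤ_[p]}
    {S : Set (localPoints W E)} (hS : S ⊆ A) (hdvd : ∀ Q ∈ S, d ∣ evalOn W A z Q) {B : localPoints W E}
    (hB : B ∈ AddSubgroup.closure S) : B ∈ A ∧ d ∣ evalOn W A z B := by
  induction hB using AddSubgroup.closure_induction with
  | mem x hx => exact ⟨hS hx, hdvd x hx⟩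
  | zero => exact ⟨A.zero_mem, by rw [evalOn_of_mem W A z A.zero_mem]; exact ⟨0, by rw [mul_zero]; exact map_zero z⟩⟩
  | add x y _ _ hx hy =>
    exact ⟨add_mem hx.1 hy.1, by rw [evalOn_add_mem W A z hx.1 hy.1]; exact dvd_add hx.2 hy.2⟩
  | neg x _ hx =>
    refine ⟨neg_mem hx.1, ?_⟩
    rw [← neg_one_zsmul, evalOn_zsmul_mem W A z hx.1]
    exact hx.2.mul_left _

/-! ## §2 `Γ`-orbits through the generator -/

/-- For a local lift `g` of the topological generator (`κ(res g) = 1`): `κ(res gʲ) = j`. [folklore] -/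
theorem toAdd_kappa_res_pow {g : Field.absoluteGaloisGroup E} (hg : κ.IsTopGenerator (resGalOfEmb ι g)) (j : ℕ) :
    (κ (resGalOfEmb ι (g ^ j))).toAdd = (j : ℤ_[p]) := by
  rw [map_pow]
  change (κ.toContinuousMonoidHom (resGalOfEmb ι g ^ j)).toAdd = _
  rw [map_pow, toAdd_pow]
  change j • (κ (resGalOfEmb ι g)).toAdd = _
  rw [hg, toAdd_ofAdd, nsmul_eq_mul, mul_one]

/-- **Every `Γ_E`-translate of a point of level `n` is a `gʲ`-translate, `j < pⁿ`** (the cosets of `Gal(Ē/K_n·E)` in `Γ_E` are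
represented by the powers `gʲ`, `j < pⁿ`). [cite: Sprung2012, §2 p. 1486 (Γ/Γ_n, γ)] -/
theorem exists_smul_eq_pow_smul {g : Field.absoluteGaloisGroup E} (hg : κ.IsTopGenerator (resGalOfEmb ι g)) {n : ℕ}
    {x : localPoints W E} (hx : x ∈ localLayerPointsOfEmb κ ι W n) (σ : Field.absoluteGaloisGroup E) :
    ∃ j < p ^ n, σ • x = g ^ j • x := by
  haveI : NeZero (p ^ n) := ⟨pow_ne_zero _ hp.out.ne_zero⟩
  set j := (PadicInt.toZModPow n (κ (resGalOfEmb ι σ)).toAdd).val with hj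
  have hmem : σ⁻¹ * g ^ j ∈ localLayerSubgroupOfEmb κ ι n := by
    rw [mem_localLayerSubgroupOfEmb_iff, map_mul, map_inv]
    change (p : ℤ_[p]) ^ n ∣ (κ.toContinuousMonoidHom ((resGalOfEmb ι σ)⁻¹ * resGalOfEmb ι (g ^ j))).toAdd
    rw [map_mul, map_inv, toAdd_mul, toAdd_inv]
    change (p : ℤ_[p]) ^ n ∣ -(κ (resGalOfEmb ι σ)).toAdd + (κ (resGalOfEmb ι (g ^ j))).toAdd
    rw [toAdd_kappa_res_pow κ ι hg, ← Ideal.mem_span_singleton, ← PadicInt.ker_toZModPow, RingHom.mem_ker, map_add,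
      map_neg, map_natCast, hj, ZMod.natCast_zmod_val, neg_add_cancel]
  refine ⟨j, ZMod.val_lt _, ?_⟩
  have hfix := (mem_localLayerPointsOfEmb_iff κ ι W n x).mp hx _ hmem
  calc σ • x = σ • ((σ⁻¹ * g ^ j) • x) := by rw [hfix]
    _ = g ^ j • x := by rw [← mul_smul, mul_inv_cancel_left]

/-! ## §3 The divisibility engine -/

/-- **The divisibility engine.** Given the primal generation data (`N` prime to `p`;
`N·P ∈ ℤ[Γ·c_m] + E(K_{m−1}·E) + p·E(K_m·E)` for `P ∈ E(K_m·E)`, `m ≥ 1`; `N·P ∈ ℤ·cneg + p·E(E)` for `P ∈ E(E)`), a functional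
`z` on `E(K_n·E)` with `p^{K} ∣ z(σ•c_m)` for all `σ ∈ Γ_E`, `m ≤ n`, and `p^{K} ∣ z(cneg)` satisfies `p^{K} ∣ z(P)` for every
`P ∈ E(K_n·E)` (induction on the exponent, then on the level). [cite: Sprung2012, Thm. 2.2 (p. 1487) (generation) and Cor. 2.10]
[cite: Kobayashi2003, Prop. 8.12] -/
theorem pow_dvd_evalOn_of_generation {N : ℕ} (hN : N.Coprime p) {cneg : localPoints W E} {c : ℕ → localPoints W E}
    (hcneg : cneg ∈ localLayerPointsOfEmb κ ι W 0) (hc : ∀ n, c n ∈ localLayerPointsOfEmb κ ι W n)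
    (hGEN : ∀ m : ℕ, 1 ≤ m → ∀ P ∈ localLayerPointsOfEmb κ ι W m,
      ∃ B ∈ AddSubgroup.closure (Set.range fun σ : Field.absoluteGaloisGroup E ↦ σ • c m),
        ∃ P' ∈ localLayerPointsOfEmb κ ι W (m - 1), ∃ R ∈ localLayerPointsOfEmb κ ι W m, N • P = B + P' + p • R)
    (hGEN0 : ∀ P ∈ localLayerPointsOfEmb κ ι W 0,
      ∃ u : ℤ, ∃ R ∈ localLayerPointsOfEmb κ ι W 0, N • P = u • cneg + p • R)
    (n K₀ : ℕ) (z : localLayerPointsOfEmb κ ι W n →+ ℤ_[p])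
    (horb : ∀ m ≤ n, ∀ σ : Field.absoluteGaloisGroup E,
      (p : ℤ_[p]) ^ K₀ ∣ evalOn W (localLayerPointsOfEmb κ ι W n) z (σ • c m))
    (hneg : (p : ℤ_[p]) ^ K₀ ∣ evalOn W (localLayerPointsOfEmb κ ι W n) z cneg) :
    ∀ P ∈ localLayerPointsOfEmb κ ι W n, (p : ℤ_[p]) ^ K₀ ∣ evalOn W (localLayerPointsOfEmb κ ι W n) z P := by
  have hmono := localLayerPointsOfEmb_mono κ ι W
  have hNu : IsUnit ((N : ℕ) : ℤ_[p]) := isUnit_natCast_of_coprime hN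
  -- induction on the exponent `k ≤ K₀`, then on the level `m ≤ n`
  suffices hmain : ∀ k, k ≤ K₀ → ∀ m, m ≤ n → ∀ P ∈ localLayerPointsOfEmb κ ι W m, (p : ℤ_[p]) ^ k ∣ evalOn W (localLayerPointsOfEmb κ ι W n) z P from
    fun P hP ↦ hmain K₀ le_rfl n le_rfl P hP
  intro k
  induction k with
  | zero => intro _ m _ P _; rw [pow_zero]; exact one_dvd _
  | succ k ih =>
    intro hk m
    induction m with
    | zero =>
      intro _ P hP
      obtain ⟨u, R, hR, hNP⟩ := hGEN0 P hP
      have hPn : P ∈ (localLayerPointsOfEmb κ ι W n) := hmono (Nat.zero_le n) hP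
      have hRn : R ∈ (localLayerPointsOfEmb κ ι W n) := hmono (Nat.zero_le n) hR
      have hcn : cneg ∈ (localLayerPointsOfEmb κ ι W n) := hmono (Nat.zero_le n) hcneg
      have key : (N : ℤ_[p]) * evalOn W (localLayerPointsOfEmb κ ι W n) z P = u * evalOn W (localLayerPointsOfEmb κ ι W n) z cneg + p * evalOn W (localLayerPointsOfEmb κ ι W n) z R := by
        rw [← evalOn_nsmul_mem W (localLayerPointsOfEmb κ ι W n) z hPn, hNP, evalOn_add_mem W (localLayerPointsOfEmb κ ι W n) z (zsmul_mem hcn u) (nsmul_mem hRn p),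
          evalOn_zsmul_mem W (localLayerPointsOfEmb κ ι W n) z hcn, evalOn_nsmul_mem W (localLayerPointsOfEmb κ ι W n) z hRn]
      have hdvd : (p : ℤ_[p]) ^ (k + 1) ∣ (N : ℤ_[p]) * evalOn W (localLayerPointsOfEmb κ ι W n) z P := by
        rw [key]
        refine dvd_add ((pow_dvd_pow _ hk).trans hneg |>.mul_left _) ?_
        rw [pow_succ']
        exact mul_dvd_mul_left _ (ih (Nat.le_of_succ_le hk) 0 (Nat.zero_le n) R hR)
      exact hNu.dvd_mul_left.mp hdvd
    | succ m ihm =>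
      intro hm P hP
      obtain ⟨B, hB, P', hP', R, hR, hNP⟩ := hGEN (m + 1) (Nat.succ_pos m) P hP
      have hPn : P ∈ (localLayerPointsOfEmb κ ι W n) := hmono hm hP
      have hRn : R ∈ (localLayerPointsOfEmb κ ι W n) := hmono hm hR
      have hP'n : P' ∈ (localLayerPointsOfEmb κ ι W n) := hmono (by omega) hP'
      have hBd : B ∈ (localLayerPointsOfEmb κ ι W n) ∧ (p : ℤ_[p]) ^ K₀ ∣ evalOn W (localLayerPointsOfEmb κ ι W n) z B := by
        refine dvd_evalOn_of_mem_closure W (localLayerPointsOfEmb κ ι W n) z ?_ ?_ hB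
        · rintro _ ⟨σ, rfl⟩; exact hmono hm (smul_mem_localLayerPointsOfEmb κ ι W (m + 1) σ (hc (m + 1)))
        · rintro _ ⟨σ, rfl⟩; exact horb (m + 1) hm σ
      have key : (N : ℤ_[p]) * evalOn W (localLayerPointsOfEmb κ ι W n) z P = evalOn W (localLayerPointsOfEmb κ ι W n) z B + evalOn W (localLayerPointsOfEmb κ ι W n) z P' + p * evalOn W (localLayerPointsOfEmb κ ι W n) z R := by
        rw [← evalOn_nsmul_mem W (localLayerPointsOfEmb κ ι W n) z hPn, hNP, evalOn_add_mem W (localLayerPointsOfEmb κ ι W n) z (add_mem hBd.1 hP'n) (nsmul_mem hRn p),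
          evalOn_add_mem W (localLayerPointsOfEmb κ ι W n) z hBd.1 hP'n, evalOn_nsmul_mem W (localLayerPointsOfEmb κ ι W n) z hRn]
      have hdvd : (p : ℤ_[p]) ^ (k + 1) ∣ (N : ℤ_[p]) * evalOn W (localLayerPointsOfEmb κ ι W n) z P := by
        rw [key]
        refine dvd_add (dvd_add ((pow_dvd_pow _ hk).trans hBd.2) (ihm (by omega) P' (by simpa using hP'))) ?_
        rw [pow_succ']
        exact mul_dvd_mul_left _ (ih (Nat.le_of_succ_le hk) (m + 1) hm R hR)
      exact hNu.dvd_mul_left.mp hdvd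

/-! ## §4 Orbit propagation through the trace relations -/

/-- **Orbit propagation.** Let `c m ∈ E(K_m·E)`, `cneg ∈ E(E)` satisfy `Tr_{m+1/m} c_{m+1} = a_p c_m − c_{m−1}` (`m ≥ 1`) and
`c_0 = (a_p − 2)·cneg` with `a_p − 2 ∈ ℤ_pˣ`, let `g` restrict to the topological generator, `n ≥ 1`, and let `z` be a functional on
`E(K_n·E)` with `p^{K} ∣ z(gʲ•c_n)` and `p^{K} ∣ z(gʲ•c_{n−1})` for all `j < pⁿ`. Then `p^{K} ∣ z(σ•c_m)` for all `σ ∈ Γ_E`, `m ≤ n`,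
and `p^{K} ∣ z(cneg)` (`Tr_{m+1/m} = ∑_{k<p} g^{p^m k}`, tree `Sprung2012.localTraceOfEmb_succ_eq_sum_pow_smul`).
[cite: Sprung2012, Thm. 2.2 (p. 1487) (the relations (1), (2))] [cite: Kobayashi2003, Lemma 8.9] -/
theorem pow_dvd_evalOn_orbit_of_relations {g : Field.absoluteGaloisGroup E} (hg : κ.IsTopGenerator (resGalOfEmb ι g)) {ap : ℤ}
    (hap : IsUnit ((ap - 2 : ℤ) : ℤ_[p])) {cneg : localPoints W E} {c : ℕ → localPoints W E}
    (hcneg : cneg ∈ localLayerPointsOfEmb κ ι W 0) (hc : ∀ n, c n ∈ localLayerPointsOfEmb κ ι W n)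
    (hR0 : c 0 = (ap - 2) • cneg)
    (hRn : ∀ m : ℕ, 1 ≤ m → localTraceOfEmb κ ι W m (m + 1) (c (m + 1)) = ap • c m - c (m - 1))
    {n : ℕ} (hn : 1 ≤ n) (K₀ : ℕ) (z : localLayerPointsOfEmb κ ι W n →+ ℤ_[p])
    (hzn : ∀ j < p ^ n, (p : ℤ_[p]) ^ K₀ ∣ evalOn W (localLayerPointsOfEmb κ ι W n) z (g ^ j • c n))
    (hzn1 : ∀ j < p ^ n, (p : ℤ_[p]) ^ K₀ ∣ evalOn W (localLayerPointsOfEmb κ ι W n) z (g ^ j • c (n - 1))) :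
    (∀ m ≤ n, ∀ σ : Field.absoluteGaloisGroup E,
      (p : ℤ_[p]) ^ K₀ ∣ evalOn W (localLayerPointsOfEmb κ ι W n) z (σ • c m)) ∧
    (p : ℤ_[p]) ^ K₀ ∣ evalOn W (localLayerPointsOfEmb κ ι W n) z cneg := by
  have hmono := localLayerPointsOfEmb_mono κ ι W
  -- all `Γ`-translates of `c_n`, `c_{n−1}` (cosets represented by powers of `g`)
  have horbn : ∀ σ : Field.absoluteGaloisGroup E, (p : ℤ_[p]) ^ K₀ ∣ evalOn W (localLayerPointsOfEmb κ ι W n) z (σ • c n) := by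
    intro σ
    obtain ⟨j, hj, hσ⟩ := exists_smul_eq_pow_smul κ ι W hg (hc n) σ
    rw [hσ]; exact hzn j hj
  have horbn1 : ∀ σ : Field.absoluteGaloisGroup E, (p : ℤ_[p]) ^ K₀ ∣ evalOn W (localLayerPointsOfEmb κ ι W n) z (σ • c (n - 1)) := by
    intro σ
    obtain ⟨j, hj, hσ⟩ := exists_smul_eq_pow_smul κ ι W hg (hmono (Nat.sub_le n 1) (hc (n - 1))) σ
    rw [hσ]; exact hzn1 j hj
  -- downward propagation: `σ•c_{m−1} = a_p σ•c_m − ∑_{k<p} (σ g^{p^m k})•c_{m+1}`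
  have hstep : ∀ m : ℕ, 1 ≤ m → m + 1 ≤ n →
      (∀ σ : Field.absoluteGaloisGroup E, (p : ℤ_[p]) ^ K₀ ∣ evalOn W (localLayerPointsOfEmb κ ι W n) z (σ • c (m + 1))) →
      (∀ σ : Field.absoluteGaloisGroup E, (p : ℤ_[p]) ^ K₀ ∣ evalOn W (localLayerPointsOfEmb κ ι W n) z (σ • c m)) →
      ∀ σ : Field.absoluteGaloisGroup E, (p : ℤ_[p]) ^ K₀ ∣ evalOn W (localLayerPointsOfEmb κ ι W n) z (σ • c (m - 1)) := by
    intro m hm hmn h1 h0 σ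
    have hrel : c (m - 1) = ap • c m - localTraceOfEmb κ ι W m (m + 1) (c (m + 1)) := by
      rw [hRn m hm]; abel
    have htr := localTraceOfEmb_succ_eq_sum_pow_smul κ ι W hg m (hc (m + 1))
    have hcm : σ • c m ∈ (localLayerPointsOfEmb κ ι W n) := hmono (by omega) (smul_mem_localLayerPointsOfEmb κ ι W m σ (hc m))
    have hterm : ∀ k ∈ range p, (σ * g ^ (p ^ m * k)) • c (m + 1) ∈ (localLayerPointsOfEmb κ ι W n) := fun k _ ↦
      hmono hmn (smul_mem_localLayerPointsOfEmb κ ι W (m + 1) _ (hc (m + 1)))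
    rw [hrel, smul_sub, htr, smul_sum, smul_comm σ ap (c m)]
    simp_rw [← mul_smul]
    rw [show ap • σ • c m - ∑ k ∈ range p, (σ * g ^ (p ^ m * k)) • c (m + 1) =
        ap • σ • c m + (-1 : ℤ) • ∑ k ∈ range p, (σ * g ^ (p ^ m * k)) • c (m + 1) by rw [neg_one_zsmul, sub_eq_add_neg],
      evalOn_add_mem W (localLayerPointsOfEmb κ ι W n) z (zsmul_mem hcm ap) (zsmul_mem ((localLayerPointsOfEmb κ ι W n).sum_mem hterm) _), evalOn_zsmul_mem W (localLayerPointsOfEmb κ ι W n) z hcm,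
      evalOn_zsmul_mem W (localLayerPointsOfEmb κ ι W n) z ((localLayerPointsOfEmb κ ι W n).sum_mem hterm), evalOn_sum_mem W (localLayerPointsOfEmb κ ι W n) z _ _ hterm]
    exact dvd_add ((h0 σ).mul_left _) ((dvd_sum fun k _ ↦ h1 _).mul_left _)
  -- induction on `i` for the pair of levels `(n − i, n − i − 1)`
  have hpair : ∀ i : ℕ, i + 1 ≤ n →
      (∀ σ : Field.absoluteGaloisGroup E, (p : ℤ_[p]) ^ K₀ ∣ evalOn W (localLayerPointsOfEmb κ ι W n) z (σ • c (n - i))) ∧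
      (∀ σ : Field.absoluteGaloisGroup E, (p : ℤ_[p]) ^ K₀ ∣ evalOn W (localLayerPointsOfEmb κ ι W n) z (σ • c (n - i - 1))) := by
    intro i
    induction i with
    | zero => intro _; exact ⟨by simpa using horbn, by simpa using horbn1⟩
    | succ i ih =>
      intro hi
      obtain ⟨h1, h0⟩ := ih (by omega)
      refine ⟨by simpa [Nat.sub_add_eq] using h0, ?_⟩
      have := hstep (n - i - 1) (by omega) (by omega) (by rwa [show n - i - 1 + 1 = n - i by omega]) h0
      rwa [show n - i - 1 - 1 = n - (i + 1) - 1 by omega] at this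
  have hall : ∀ m ≤ n, ∀ σ : Field.absoluteGaloisGroup E, (p : ℤ_[p]) ^ K₀ ∣ evalOn W (localLayerPointsOfEmb κ ι W n) z (σ • c m) := by
    intro m hm σ
    by_cases hmn : m = n
    · subst hmn; exact horbn σ
    · have := (hpair (n - m - 1) (by omega)).2 σ
      rwa [show n - (n - m - 1) - 1 = m by omega] at this
  refine ⟨hall, ?_⟩
  -- `cneg` from `c_0 = (a_p − 2)·cneg`
  have hcn : cneg ∈ (localLayerPointsOfEmb κ ι W n) := hmono (Nat.zero_le n) hcneg
  have h0 := hall 0 (Nat.zero_le n) 1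
  rw [one_smul, hR0, evalOn_zsmul_mem W (localLayerPointsOfEmb κ ι W n) z hcn] at h0
  exact hap.dvd_mul_left.mp h0

end SprungHonda

end Summit.BirchSwinnertonDyer.BirchSwinnertonDyer.Theorems

end
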